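import Literature.Analysis.FluidPDE.BourgainPavlovicBudget
import Mathlib.MeasureTheory.Constructions.HaarToSphere
import HarnessLib

/-!
# The Bourgain–Pavlović remainder equation and its bootstrap

Ninth support file for the discharge of the barrier
`Literature.Barriers.NavierStokesRegularity.CriticalBesovNormInflation` (Bourgain–Pavlović 2008,
Thm. 1.1): the control of the remainder `y = u − e^{tΔ}u₀ + u₁` of Bourgain–Pavlović's §3.3
((3.13)–(3.39)), on the Fourier side and in the band Lei–Lin path norm `pathNorm` of
`NSFourierPathNorm` instead of their `X_T`. For a Fourier-side mild solution `V` on `[0, F]`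
issued from the datum `a₀` (`IsFourierMild (4π²) 4 0 F V`, `V 0 = a₀`) the remainder
`y = V − Uᶜ + u₁ᶜ` satisfies the exact identity (bilinearity of the tree's `nonlin`)

  `y = −𝓑(y, V) + 𝓑(u₁, V) − 𝓑(Uᶜ, y) + 𝓑(Uᶜ, u₁)`,  `𝓑 = duhamelBilin (4π²)`,

on `[0, F]` (`remainder_identity`; Bourgain–Pavlović's (3.13) with the unknown kept whole in two
of the four terms). Feeding the four terms to `pathNorm_duhamelBilin_le` and the coefficient
budgets of `BourgainPavlovicBudget` gives the **main inequality** (`remainder_main_inequality`)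

  `Z ≤ ε + λ Z + C_G Z_∞ Z₁`,  `Z = pathNorm F y`, `Z_∞ = pathNormInf F y`, `Z₁ = pathNormOne F y`,

with `λ = C_G (12 α m + 96 α² r m² √T + 4000 α² m²)` and
`ε = C_G (1320 α³ r m³ + 2304 α⁴ r² m⁴ T + 219000 α⁴ r m⁴)`, and a **bootstrap in the length of
the interval** — discrete, through the Lipschitz bound of `F ↦ Z₁(F)` supplied by the a priori
decay of `V` — closes it: if `λ ≤ 1/4` and `16 C_G ε ≤ 1` then `pathNorm F y ≤ 2ε`
(`remainder_pathNorm_le`; Bourgain–Pavlović's (3.39), `‖y‖_{X_T} ≲ Q³ T^{1/2} + …`).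

Generic additions (namespace `FourierNS`): `duhamelBilin_sub_left/right`, comparison and
subadditivity of `pathNorm` under pointwise norm bounds, `∫₀ᵀ massL1(y)² ≤ Z_∞ Z₁`, the splitting
of `pathNormOne` at an intermediate time, and the **finiteness of the path norm** of a continuous
family with decay of order `5` (the weight `‖ξ‖⁻¹ (1+‖ξ‖)⁻⁵` is integrable on `ℝ³`, by the radial
reduction `integrable_fun_norm_addHaar`).

## References

* J. Bourgain, N. Pavlović, J. Funct. Anal. 255 (2008), §3.3, (3.13)–(3.39). [BourgainPavlovic2008]
* Z. Lei, F. Lin, Comm. Pure Appl. Math. 64 (2011), Thm. 1.1. [LeiLin2011]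
-/

noncomputable section

open MeasureTheory Real Set Filter Topology Function Complex
open scoped ENNReal NNReal

/-! ### Generic additions -/

namespace Literature.Analysis.FluidPDE.FourierNS

section Generic

variable {ι : Type*} [Fintype ι] [DecidableEq ι]

/-- Continuity in time of `r ↦ heat c ξ (t - r) • nonlin (v r) (w r) ξ` for jointly continuous,
uniformly decaying inputs (interval integrability of the Duhamel integrand). [folklore] -/
theorem continuous_heat_smul_nonlin {K₀ : ℕ} (hK₀ : Fintype.card ι < K₀) (c : ℝ)
    {v w : ℝ → EuclideanSpace ℝ ι → ι → ℂ} {A B : ℝ} (hvc : Continuous (uncurry v))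
    (hwc : Continuous (uncurry w)) (hv : ∀ t, HasDecay K₀ A (v t)) (hw : ∀ t, HasDecay K₀ B (w t))
    (t : ℝ) (ξ : EuclideanSpace ℝ ι) :
    Continuous fun r => heat c ξ (t - r) • nonlin (v r) (w r) ξ := by
  have hN : Continuous fun r => nonlin (v r) (w r) ξ :=
    continuous_nonlin_param (X := ℝ) hK₀ (V := fun r => v r) (W := fun r => w r) (ζ := fun _ => ξ)
      (fun r => (hvc.uncurry_left r).aestronglyMeasurable)
      (fun r => (hwc.uncurry_left r).aestronglyMeasurable) (fun r => hv r) (fun r => hw r)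
      (fun _ => hvc.comp (continuous_id.prodMk continuous_const))
      (fun _ => hwc.comp (continuous_id.prodMk continuous_const)) continuous_const
  exact (continuous_heat_comp c continuous_const (continuous_const.sub continuous_id)).smul hN

/-- **Bilinearity of the Duhamel term: differences in the first slot.** [folklore] -/
theorem duhamelBilin_sub_left {K₀ : ℕ} (hK₀ : Fintype.card ι < K₀) (c : ℝ)
    {v₁ v₂ w : ℝ → EuclideanSpace ℝ ι → ι → ℂ} {A₁ A₂ B : ℝ}
    (hv₁c : Continuous (uncurry v₁)) (hv₂c : Continuous (uncurry v₂)) (hwc : Continuous (uncurry w))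
    (hv₁ : ∀ t, HasDecay K₀ A₁ (v₁ t)) (hv₂ : ∀ t, HasDecay K₀ A₂ (v₂ t)) (hw : ∀ t, HasDecay K₀ B (w t))
    (t : ℝ) (ξ : EuclideanSpace ℝ ι) :
    duhamelBilin c (v₁ - v₂) w t ξ = duhamelBilin c v₁ w t ξ - duhamelBilin c v₂ w t ξ := by
  simp only [duhamelBilin_apply]
  have hpt : ∀ r, nonlin ((v₁ - v₂) r) (w r) ξ = nonlin (v₁ r) (w r) ξ - nonlin (v₂ r) (w r) ξ :=
    fun r => nonlin_sub_left hK₀ (hv₁ r) (hv₂ r) (hw r) (hv₁c.uncurry_left r).aestronglyMeasurable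
      (hv₂c.uncurry_left r).aestronglyMeasurable (hwc.uncurry_left r).aestronglyMeasurable ξ
  simp_rw [hpt, smul_sub]
  exact intervalIntegral.integral_sub
    ((continuous_heat_smul_nonlin hK₀ c hv₁c hwc hv₁ hw t ξ).intervalIntegrable _ _)
    ((continuous_heat_smul_nonlin hK₀ c hv₂c hwc hv₂ hw t ξ).intervalIntegrable _ _)

/-- **Bilinearity of the Duhamel term: differences in the second slot.** [folklore] -/
theorem duhamelBilin_sub_right {K₀ : ℕ} (hK₀ : Fintype.card ι < K₀) (c : ℝ)
    {v w₁ w₂ : ℝ → EuclideanSpace ℝ ι → ι → ℂ} {A B₁ B₂ : ℝ}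
    (hvc : Continuous (uncurry v)) (hw₁c : Continuous (uncurry w₁)) (hw₂c : Continuous (uncurry w₂))
    (hv : ∀ t, HasDecay K₀ A (v t)) (hw₁ : ∀ t, HasDecay K₀ B₁ (w₁ t)) (hw₂ : ∀ t, HasDecay K₀ B₂ (w₂ t))
    (t : ℝ) (ξ : EuclideanSpace ℝ ι) :
    duhamelBilin c v (w₁ - w₂) t ξ = duhamelBilin c v w₁ t ξ - duhamelBilin c v w₂ t ξ := by
  simp only [duhamelBilin_apply]
  have hpt : ∀ r, nonlin (v r) ((w₁ - w₂) r) ξ = nonlin (v r) (w₁ r) ξ - nonlin (v r) (w₂ r) ξ :=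
    fun r => nonlin_sub_right hK₀ (hv r) (hw₁ r) (hw₂ r) (hvc.uncurry_left r).aestronglyMeasurable
      (hw₁c.uncurry_left r).aestronglyMeasurable (hw₂c.uncurry_left r).aestronglyMeasurable ξ
  simp_rw [hpt, smul_sub]
  exact intervalIntegral.integral_sub
    ((continuous_heat_smul_nonlin hK₀ c hvc hw₁c hv hw₁ t ξ).intervalIntegrable _ _)
    ((continuous_heat_smul_nonlin hK₀ c hvc hw₂c hv hw₂ t ξ).intervalIntegrable _ _)

variable [Nonempty ι]

omit [DecidableEq ι] [Nonempty ι] in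
/-- **Comparison of path norms under a pointwise norm bound on `[0, T]`.** [folklore] -/
theorem pathNorm_mono_of_norm_le {T : ℝ} {Φ Ψ : ℝ → EuclideanSpace ℝ ι → ι → ℂ}
    (h : ∀ t ∈ Icc 0 T, ∀ ξ, ‖Φ t ξ‖ ≤ ‖Ψ t ξ‖) : pathNorm T Φ ≤ pathNorm T Ψ := by
  have hpt : ∀ t ∈ Icc 0 T, ∀ ξ, ‖Φ t ξ‖ₑ ≤ ‖Ψ t ξ‖ₑ := fun t ht ξ => by
    rw [← ofReal_norm, ← ofReal_norm]; exact ENNReal.ofReal_le_ofReal (h t ht ξ)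
  refine add_le_add ?_ ?_
  · refine ENNReal.tsum_le_tsum fun b => bandSup_le fun t ht => ?_
    calc ∫⁻ ξ in band ι b, ‖ξ‖ₑ⁻¹ * ‖Φ t ξ‖ₑ ≤ ∫⁻ ξ in band ι b, ‖ξ‖ₑ⁻¹ * ‖Ψ t ξ‖ₑ :=
          lintegral_mono fun ξ => mul_le_mul' le_rfl (hpt t ht ξ)
      _ ≤ bandSup T Ψ b := setLIntegral_band_le_bandSup ht b
  · refine setLIntegral_mono' measurableSet_Ioc fun t ht => ?_
    exact lintegral_mono fun ξ => mul_le_mul' le_rfl (hpt t ⟨ht.1.le, ht.2⟩ ξ)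

omit [DecidableEq ι] [Nonempty ι] in
/-- Path norms of families agreeing on `[0, T]` agree. [folklore] -/
theorem pathNorm_congr {T : ℝ} {Φ Ψ : ℝ → EuclideanSpace ℝ ι → ι → ℂ}
    (h : ∀ t ∈ Icc 0 T, ∀ ξ, Φ t ξ = Ψ t ξ) : pathNorm T Φ = pathNorm T Ψ :=
  le_antisymm (pathNorm_mono_of_norm_le fun t ht ξ => (congrArg _ (h t ht ξ)).le)
    (pathNorm_mono_of_norm_le fun t ht ξ => (congrArg _ (h t ht ξ)).ge)

omit [DecidableEq ι] [Nonempty ι] in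
/-- **Subadditivity of the path norm under a pointwise bound `‖Θ‖ ≤ ‖Φ‖ + ‖Ψ‖` on `[0, T]`.** [folklore] -/
theorem pathNorm_le_add_of_norm_le {T : ℝ} {Θ Φ Ψ : ℝ → EuclideanSpace ℝ ι → ι → ℂ}
    (hΦ : Continuous (uncurry Φ))
    (h : ∀ t ∈ Icc 0 T, ∀ ξ, ‖Θ t ξ‖ ≤ ‖Φ t ξ‖ + ‖Ψ t ξ‖) :
    pathNorm T Θ ≤ pathNorm T Φ + pathNorm T Ψ := by
  have hpt : ∀ t ∈ Icc 0 T, ∀ ξ, ‖Θ t ξ‖ₑ ≤ ‖Φ t ξ‖ₑ + ‖Ψ t ξ‖ₑ := fun t ht ξ => by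
    rw [← ofReal_norm, ← ofReal_norm, ← ofReal_norm, ← ENNReal.ofReal_add (norm_nonneg _) (norm_nonneg _)]
    exact ENNReal.ofReal_le_ofReal (h t ht ξ)
  have hmΦ : ∀ t, Measurable fun ξ => ‖Φ t ξ‖ₑ := fun t => (hΦ.uncurry_left t).measurable.enorm
  rw [pathNorm, pathNorm, pathNorm, add_add_add_comm]
  refine add_le_add ?_ ?_
  · rw [pathNormInf, pathNormInf, pathNormInf, ← ENNReal.tsum_add]
    refine ENNReal.tsum_le_tsum fun b => bandSup_le fun t ht => ?_
    calc ∫⁻ ξ in band ι b, ‖ξ‖ₑ⁻¹ * ‖Θ t ξ‖ₑ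
        ≤ ∫⁻ ξ in band ι b, (‖ξ‖ₑ⁻¹ * ‖Φ t ξ‖ₑ + ‖ξ‖ₑ⁻¹ * ‖Ψ t ξ‖ₑ) :=
          lintegral_mono fun ξ => by rw [← mul_add]; exact mul_le_mul' le_rfl (hpt t ht ξ)
      _ = (∫⁻ ξ in band ι b, ‖ξ‖ₑ⁻¹ * ‖Φ t ξ‖ₑ) + ∫⁻ ξ in band ι b, ‖ξ‖ₑ⁻¹ * ‖Ψ t ξ‖ₑ :=
          lintegral_add_left' (show AEMeasurable (fun ξ : EuclideanSpace ℝ ι => ‖ξ‖ₑ⁻¹ * ‖Φ t ξ‖ₑ) _ from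
            (measurable_enorm.inv.mul (hmΦ t)).aemeasurable) _
      _ ≤ bandSup T Φ b + bandSup T Ψ b :=
          add_le_add (setLIntegral_band_le_bandSup (Φ := Φ) ht b) (setLIntegral_band_le_bandSup (Φ := Ψ) ht b)
  · rw [pathNormOne, pathNormOne, pathNormOne,
      ← lintegral_add_left' (show AEMeasurable (fun t => xPos (Φ t)) _ from (measurable_xPos hΦ).aemeasurable)]
    refine setLIntegral_mono' measurableSet_Ioc fun t ht => ?_
    calc xPos (Θ t) ≤ ∫⁻ ξ, (‖ξ‖ₑ * ‖Φ t ξ‖ₑ + ‖ξ‖ₑ * ‖Ψ t ξ‖ₑ) :=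
          lintegral_mono fun ξ => by rw [← mul_add]; exact mul_le_mul' le_rfl (hpt t ⟨ht.1.le, ht.2⟩ ξ)
      _ = xPos (Φ t) + xPos (Ψ t) :=
          lintegral_add_left' (show AEMeasurable (fun ξ : EuclideanSpace ℝ ι => ‖ξ‖ₑ * ‖Φ t ξ‖ₑ) _ from
            (measurable_enorm.mul (hmΦ t)).aemeasurable) _

omit [DecidableEq ι] in
/-- **The quadratic term against the path norm**: `∫₀ᵀ massL1(y r)² dr ≤ Z_∞ · Z₁`
(the interpolation `massL1² ≤ xNeg · xPos` slice by slice). [cite: LeiLin2011, Thm. 1.1] -/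
theorem lintegral_massL1_mul_self_le (T : ℝ) {y : ℝ → EuclideanSpace ℝ ι → ι → ℂ}
    (hy : Continuous (uncurry y)) :
    ∫⁻ r in Ioc 0 T, massL1 (y r) * massL1 (y r) ≤ pathNormInf T y * pathNormOne T y := by
  calc ∫⁻ r in Ioc 0 T, massL1 (y r) * massL1 (y r) ≤ ∫⁻ r in Ioc 0 T, pathNormInf T y * xPos (y r) := by
        refine setLIntegral_mono' measurableSet_Ioc fun r hr => ?_
        calc massL1 (y r) * massL1 (y r) = massL1 (y r) ^ 2 := (sq _).symm
          _ ≤ xNeg (y r) * xPos (y r) := massL1_sq_le (hy.uncurry_left r).aestronglyMeasurable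
          _ ≤ pathNormInf T y * xPos (y r) := mul_le_mul' (xNeg_le_pathNormInf ⟨hr.1.le, hr.2⟩) le_rfl
    _ = pathNormInf T y * pathNormOne T y := by
        rw [lintegral_const_mul _ (measurable_xPos hy)]; rfl

omit [DecidableEq ι] [Nonempty ι] in
/-- **Splitting `pathNormOne` at an intermediate time**: for `0 ≤ T ≤ T'`,
`pathNormOne T' y ≤ pathNormOne T y + ∫_{(T,T']} xPos (y t) dt`. [folklore] -/
theorem pathNormOne_le_add_setLIntegral {T T' : ℝ} (hT : 0 ≤ T) (hTT' : T ≤ T')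
    (y : ℝ → EuclideanSpace ℝ ι → ι → ℂ) :
    pathNormOne T' y ≤ pathNormOne T y + ∫⁻ t in Ioc T T', xPos (y t) := by
  rw [pathNormOne, pathNormOne, ← Ioc_union_Ioc_eq_Ioc hT hTT']
  exact lintegral_union_le _ _ _

omit [DecidableEq ι] [Nonempty ι] in
/-- `bandSup` is monotone in `T`. [folklore] -/
theorem bandSup_mono {T T' : ℝ} (h : T ≤ T') (y : ℝ → EuclideanSpace ℝ ι → ι → ℂ) (b : ℤ) :
    bandSup T y b ≤ bandSup T' y b :=
  bandSup_le fun _ ht => setLIntegral_band_le_bandSup ⟨ht.1, ht.2.trans h⟩ b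

omit [DecidableEq ι] [Nonempty ι] in
/-- `pathNormInf` is monotone in `T`. [folklore] -/
theorem pathNormInf_mono {T T' : ℝ} (h : T ≤ T') (y : ℝ → EuclideanSpace ℝ ι → ι → ℂ) :
    pathNormInf T y ≤ pathNormInf T' y :=
  ENNReal.tsum_le_tsum fun b => bandSup_mono h y b

omit [DecidableEq ι] [Nonempty ι] in
/-- `pathNormOne` is monotone in `T`. [folklore] -/
theorem pathNormOne_mono {T T' : ℝ} (h : T ≤ T') (y : ℝ → EuclideanSpace ℝ ι → ι → ℂ) :
    pathNormOne T y ≤ pathNormOne T' y :=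
  lintegral_mono_set (Ioc_subset_Ioc_right h)

omit [DecidableEq ι] [Nonempty ι] in
/-- `pathNorm` is monotone in `T`. [folklore] -/
theorem pathNorm_mono {T T' : ℝ} (h : T ≤ T') (y : ℝ → EuclideanSpace ℝ ι → ι → ℂ) :
    pathNorm T y ≤ pathNorm T' y :=
  add_le_add (pathNormInf_mono h y) (pathNormOne_mono h y)

end Generic

/-! ### Finiteness of the path norm in dimension three -/

section Finite

/-- Local notation for frequency space `ℝ³`. -/
local notation "E3" => EuclideanSpace ℝ (Fin 3)

/-- The `𝒳¹` weight mass `W₁ = ∫ ‖ξ‖ (1+‖ξ‖)⁻⁵ dξ` on `ℝ³`. [folklore] -/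
def weightOne : ℝ≥0∞ := ∫⁻ ξ : E3, ‖ξ‖ₑ * ENNReal.ofReal (((1 + ‖ξ‖) ^ 5)⁻¹)

/-- The `𝒳⁻¹` weight mass `W₋₁ = ∫ ‖ξ‖⁻¹ (1+‖ξ‖)⁻⁵ dξ` on `ℝ³`. [folklore] -/
def weightNegOne : ℝ≥0∞ := ∫⁻ ξ : E3, ‖ξ‖ₑ⁻¹ * ENNReal.ofReal (((1 + ‖ξ‖) ^ 5)⁻¹)

/-- `W₁ < ∞` (`‖ξ‖(1+‖ξ‖)⁻⁵ ≤ (1+‖ξ‖)⁻⁴`, integrable on `ℝ³`). [folklore] -/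
theorem weightOne_lt_top : weightOne < ⊤ := by
  have hint : Integrable (fun ξ : E3 => ((1 + ‖ξ‖) ^ 4)⁻¹) :=
    integrable_inv_one_add_norm_pow (by rw [finrank_euclideanSpace, Fintype.card_fin]; norm_num)
  have hlt := hint.lintegral_lt_top
  refine lt_of_le_of_lt ?_ hlt
  refine lintegral_mono fun ξ => ?_
  rw [← ofReal_norm, ← ENNReal.ofReal_mul (norm_nonneg _)]
  refine ENNReal.ofReal_le_ofReal ?_
  have h1 : 0 < 1 + ‖ξ‖ := by positivity
  rw [show (1 + ‖ξ‖) ^ 5 = (1 + ‖ξ‖) ^ 4 * (1 + ‖ξ‖) by ring, mul_inv, ← mul_assoc, mul_comm ‖ξ‖,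
    mul_assoc]
  apply mul_le_of_le_one_right (by positivity)
  rw [mul_inv_le_iff₀ h1]; linarith [norm_nonneg ξ]

/-- `W₋₁ < ∞`: the weight `‖ξ‖⁻¹ (1+‖ξ‖)⁻⁵` is integrable on `ℝ³` (radial reduction:
`r² · r⁻¹ (1+r)⁻⁵ ≤ (1+r)⁻⁴` on `(0, ∞)`). [folklore] -/
theorem weightNegOne_lt_top : weightNegOne < ⊤ := by
  -- the real-valued weight as a function of the norm
  set f : ℝ → ℝ := fun s => s⁻¹ * ((1 + s) ^ 5)⁻¹ with hf
  have hrad : IntegrableOn (fun s : ℝ => s ^ (Module.finrank ℝ E3 - 1) • f s) (Ioi 0) := by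
    rw [finrank_euclideanSpace, Fintype.card_fin]
    have hint : Integrable (fun s : ℝ => ((1 + ‖s‖) ^ 4)⁻¹) :=
      integrable_inv_one_add_norm_pow (by rw [Module.finrank_self]; norm_num)
    refine Integrable.mono' hint.integrableOn ?_ ?_
    · refine (Measurable.aestronglyMeasurable ?_)
      simp only [hf]
      fun_prop
    · rw [ae_restrict_iff' measurableSet_Ioi]
      refine Eventually.of_forall fun s (hs : 0 < s) => ?_
      simp only [hf, smul_eq_mul, Real.norm_eq_abs, abs_of_pos hs, Nat.add_one_sub_one]
      rw [show s ^ 2 * (s⁻¹ * ((1 + s) ^ 5)⁻¹) = s * ((1 + s) ^ 5)⁻¹ by field_simp]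
      rw [abs_of_nonneg (by positivity)]
      have h1 : 0 < 1 + s := by linarith
      rw [show (1 + s) ^ 5 = (1 + s) ^ 4 * (1 + s) by ring, mul_inv, ← mul_assoc, mul_comm s, mul_assoc]
      apply mul_le_of_le_one_right (by positivity)
      rw [mul_inv_le_iff₀ h1]; linarith
  have hint : Integrable (fun ξ : E3 => f ‖ξ‖) := (integrable_fun_norm_addHaar volume).2 hrad
  have hlt := hint.lintegral_lt_top
  refine lt_of_le_of_lt (le_of_eq ?_) hlt
  -- the two integrands agree off the origin
  refine lintegral_congr_ae ?_
  have h0 : ∀ᵐ ξ : E3 ∂volume, ξ ≠ 0 := by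
    rw [ae_iff]; simp
  filter_upwards [h0] with ξ hξ
  have hn : 0 < ‖ξ‖ := norm_pos_iff.2 hξ
  simp only [hf]
  rw [ENNReal.ofReal_mul (by positivity), ← ofReal_norm, ENNReal.ofReal_inv_of_pos hn]

/-- **The `𝒳¹` weight of a field with decay of order `5`**: `xPos Φ ≤ A · W₁`. [folklore] -/
theorem xPos_le_of_hasDecay {A : ℝ} {Φ : E3 → Fin 3 → ℂ} (h : HasDecay 5 A Φ) :
    xPos Φ ≤ ENNReal.ofReal A * weightOne := by
  rw [xPos, weightOne, ← lintegral_const_mul' _ _ ENNReal.ofReal_ne_top]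
  refine lintegral_mono fun ξ => ?_
  rw [← mul_assoc, mul_comm (ENNReal.ofReal A), mul_assoc]
  refine mul_le_mul' le_rfl ?_
  rw [← ofReal_norm, ← ENNReal.ofReal_mul h.nonneg]
  exact ENNReal.ofReal_le_ofReal (h ξ)

/-- **The band `𝒳⁻¹` weights of a field with decay of order `5` sum to at most `A · W₋₁`.** [folklore] -/
theorem tsum_band_le_of_hasDecay {A : ℝ} {Φ : E3 → Fin 3 → ℂ} (h : HasDecay 5 A Φ) :
    ∑' b : ℤ, ∫⁻ ξ in band (Fin 3) b, ‖ξ‖ₑ⁻¹ * ‖Φ ξ‖ₑ ≤ ENNReal.ofReal A * weightNegOne := by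
  rw [← lintegral_eq_tsum_band, weightNegOne, ← lintegral_const_mul' _ _ ENNReal.ofReal_ne_top]
  refine lintegral_mono fun ξ => ?_
  rw [← mul_assoc, mul_comm (ENNReal.ofReal A), mul_assoc]
  refine mul_le_mul' le_rfl ?_
  rw [← ofReal_norm, ← ENNReal.ofReal_mul h.nonneg]
  exact ENNReal.ofReal_le_ofReal (h ξ)

/-- **Finiteness of the path norm** of a family with decay of order `5` on `[0, T]`. [folklore] -/
theorem pathNorm_lt_top {T : ℝ} {y : ℝ → E3 → Fin 3 → ℂ} {A : ℝ}
    (hdec : ∀ t ∈ Icc 0 T, HasDecay 5 A (y t)) : pathNorm T y < ⊤ := by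
  rcases lt_or_ge T 0 with hT | hT
  · -- empty interval: both pieces vanish
    have h1 : pathNormInf T y = 0 := by
      rw [pathNormInf, ENNReal.tsum_eq_zero]
      intro b
      refine le_antisymm (bandSup_le fun t ht => ?_) bot_le
      exact absurd (ht.1.trans ht.2) (not_le.2 hT)
    have h2 : pathNormOne T y = 0 := by
      rw [pathNormOne, Ioc_eq_empty (not_lt.2 hT.le), Measure.restrict_empty, lintegral_zero_measure]
    rw [pathNorm, h1, h2, add_zero]
    exact ENNReal.zero_lt_top
  · have hA0 : 0 ≤ A := (hdec 0 ⟨le_rfl, hT⟩).nonneg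
    have hprof : ∀ t ∈ Icc 0 T, ∀ ξ : E3, ‖y t ξ‖ₑ ≤ ENNReal.ofReal A * ENNReal.ofReal (((1 + ‖ξ‖) ^ 5)⁻¹) := by
      intro t ht ξ
      rw [← ofReal_norm, ← ENNReal.ofReal_mul hA0]
      exact ENNReal.ofReal_le_ofReal (hdec t ht ξ)
    refine ENNReal.add_lt_top.2 ⟨?_, ?_⟩
    · -- `pathNormInf ≤ A · W₋₁`
      refine lt_of_le_of_lt ?_ (ENNReal.mul_lt_top ENNReal.ofReal_lt_top weightNegOne_lt_top : ENNReal.ofReal A * weightNegOne < ⊤)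
      calc pathNormInf T y
          ≤ ∑' b : ℤ, ∫⁻ ξ in band (Fin 3) b, ‖ξ‖ₑ⁻¹ * (ENNReal.ofReal A * ENNReal.ofReal (((1 + ‖ξ‖) ^ 5)⁻¹)) :=
            ENNReal.tsum_le_tsum fun b => bandSup_le fun t ht =>
              lintegral_mono fun ξ => mul_le_mul' le_rfl (hprof t ht ξ)
        _ = ∫⁻ ξ : E3, ‖ξ‖ₑ⁻¹ * (ENNReal.ofReal A * ENNReal.ofReal (((1 + ‖ξ‖) ^ 5)⁻¹)) :=
            (lintegral_eq_tsum_band _).symm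
        _ = ENNReal.ofReal A * weightNegOne := by
            rw [weightNegOne, ← lintegral_const_mul' _ _ ENNReal.ofReal_ne_top]
            refine lintegral_congr fun ξ => ?_
            ring
    · -- `pathNormOne ≤ A · W₁ · T`
      refine lt_of_le_of_lt ?_ (ENNReal.mul_lt_top (ENNReal.mul_lt_top ENNReal.ofReal_lt_top weightOne_lt_top)
        ENNReal.ofReal_lt_top : ENNReal.ofReal A * weightOne * ENNReal.ofReal T < ⊤)
      calc pathNormOne T y ≤ ∫⁻ t in Ioc (0 : ℝ) T, ENNReal.ofReal A * weightOne :=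
            setLIntegral_mono' measurableSet_Ioc fun t ht => xPos_le_of_hasDecay (hdec t ⟨ht.1.le, ht.2⟩)
        _ = ENNReal.ofReal A * weightOne * ENNReal.ofReal T := by
            rw [setLIntegral_const, Real.volume_Ioc, sub_zero]

end Finite

end Literature.Analysis.FluidPDE.FourierNS

/-! ### The clamped second iterate, the remainder and its identity -/

namespace Literature.Analysis.FluidPDE.BourgainPavlovic

open FourierNS Literature.Analysis.FunctionSpaces

/-- Local notation for frequency space `ℝ³`. -/
local notation "E3" => EuclideanSpace ℝ (Fin 3)

namespace InflationParams

variable (d : InflationParams)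

/-- `∫₀ᵗ e^{-γ r} dr ≤ 1/γ` (`γ > 0`, any `t`). [folklore] -/
theorem integral_exp_neg_le' {γ : ℝ} (hγ : 0 < γ) (t : ℝ) :
    ∫ r in (0 : ℝ)..t, Real.exp (-γ * r) ≤ 1 / γ := by
  have hderiv : ∀ r ∈ Set.uIcc (0 : ℝ) t,
      HasDerivAt (fun r => -Real.exp (-γ * r) / γ) (Real.exp (-γ * r)) r := by
    intro r _
    have h1 : HasDerivAt (fun r => -γ * r) (-γ) r := by simpa using (hasDerivAt_id r).const_mul (-γ)
    have h2 := (h1.exp.neg).div_const γ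
    have h3 : -(Real.exp (-γ * r) * -γ) / γ = Real.exp (-γ * r) := by field_simp
    rw [h3] at h2
    exact h2
  have hcont : Continuous fun r => Real.exp (-γ * r) := by fun_prop
  rw [intervalIntegral.integral_eq_sub_of_hasDerivAt hderiv (hcont.intervalIntegrable _ _)]
  simp only [mul_zero, Real.exp_zero]
  have : 0 ≤ Real.exp (-γ * t) / γ := by positivity
  rw [show -Real.exp (-γ * t) / γ - -1 / γ = 1 / γ - Real.exp (-γ * t) / γ by ring]
  linarith

/-- **The free evolution decays in time at the rate of its lowest frequency**:
`‖Uᶜ(t, ξ)‖ ≤ e^{-144π² t⁺} ‖a₀(ξ)‖` (`a₀` lives on `‖ξ‖ ≥ 6`, where `e^{-4π²‖ξ‖²t} ≤ e^{-144π²t}`). [folklore] -/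
theorem norm_freeC_le_exp (t : ℝ) (ξ : E3) :
    ‖d.freeC t ξ‖ ≤ Real.exp (-(144 * π ^ 2) * max t 0) * ‖d.datum ξ‖ := by
  have ht0 : 0 ≤ max t 0 := le_max_right _ _
  by_cases hξ : ‖ξ‖ ≤ 6
  · rw [d.freeC_eq_zero_of_norm_le_six t hξ, norm_zero]; positivity
  · push Not at hξ
    rw [freeC, free_apply, norm_smul, Real.norm_of_nonneg (heat_nonneg _ _ _)]
    refine mul_le_mul_of_nonneg_right ?_ (norm_nonneg _)
    rw [heat]
    refine Real.exp_le_exp.2 ?_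
    have h36 : (36 : ℝ) ≤ ‖ξ‖ ^ 2 := by nlinarith [norm_nonneg ξ]
    have : 0 ≤ π ^ 2 * max t 0 := by positivity
    nlinarith

/-- **Time-exponential decay bounds of the free evolution**, of every order. [folklore] -/
theorem hasDecay_freeC_exp (t : ℝ) (K : ℕ) :
    HasDecay K (Real.exp (-(144 * π ^ 2) * max t 0) * (4 * d.α * d.r * d.suppRadius * (1 + d.suppRadius) ^ K))
      (d.freeC t) := fun ξ => by
  calc ‖d.freeC t ξ‖ ≤ Real.exp (-(144 * π ^ 2) * max t 0) * ‖d.datum ξ‖ := d.norm_freeC_le_exp t ξ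
    _ ≤ Real.exp (-(144 * π ^ 2) * max t 0) * (4 * d.α * d.r * d.suppRadius * (1 + d.suppRadius) ^ K *
        ((1 + ‖ξ‖) ^ K)⁻¹) := mul_le_mul_of_nonneg_left (d.hasDecay_datum K ξ) (Real.exp_pos _).le
    _ = _ := by ring

/-- **Uniform decay of the second iterate for all positive times**: the two free factors decay in
time at rate `144π²` each, so the Duhamel integral converges uniformly in `t ≥ 0`. [folklore] -/
theorem hasDecay_secondIterate_uniform (K : ℕ) : ∃ B : ℝ, ∀ t, 0 ≤ t → HasDecay K B (d.secondIterate t) := by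
  set A₀ : ℝ := 4 * d.α * d.r * d.suppRadius * (1 + d.suppRadius) ^ 4 with hA₀
  set A₁ : ℝ := 4 * d.α * d.r * d.suppRadius * (1 + d.suppRadius) ^ (K + 1) with hA₁
  set γ : ℝ := 144 * π ^ 2 with hγ
  have hγ0 : 0 < γ := by positivity
  set M : ℝ := nonlinConst (Fin 3) (K + 1) 4 * (A₁ * A₀ + A₀ * A₁) with hM
  have hM0 : 0 ≤ M := by
    have := nonlinConst_nonneg (ι := Fin 3) (K + 1) 4
    have hs := d.suppRadius_pos
    have := d.α_pos
    positivity
  refine ⟨M * (1 / (2 * γ)), fun t ht ξ => ?_⟩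
  -- the integrand decays like `e^{-2γ r}` in time
  have hnl : ∀ r, 0 ≤ r → ‖nonlin (d.freeC r) (d.freeC r) ξ‖ ≤ M * Real.exp (-(2 * γ) * r) * ((1 + ‖ξ‖) ^ K)⁻¹ := by
    intro r hr
    have e : Real.exp (-(144 * π ^ 2) * max r 0) = Real.exp (-γ * r) := by rw [hγ, max_eq_left hr]
    have h0 := d.hasDecay_freeC_exp r 4
    have h1 := d.hasDecay_freeC_exp r (K + 1)
    rw [e] at h0 h1
    have h := hasDecay_nonlin (ι := Fin 3) card_fin_three_lt_four h0 h1 h0 h1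
      ((d.continuous_freeC.uncurry_left r).aestronglyMeasurable)
      ((d.continuous_freeC.uncurry_left r).aestronglyMeasurable) ξ
    calc ‖nonlin (d.freeC r) (d.freeC r) ξ‖ ≤ _ := h
      _ = M * Real.exp (-(2 * γ) * r) * ((1 + ‖ξ‖) ^ K)⁻¹ := by
          rw [hM, hA₀, hA₁, show -(2 * γ) * r = -γ * r + -γ * r by ring, Real.exp_add]; ring
  rw [secondIterate, duhamelBilin_apply]
  have hint : IntervalIntegrable (fun r => M * Real.exp (-(2 * γ) * r) * ((1 + ‖ξ‖) ^ K)⁻¹) volume 0 t :=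
    (by fun_prop : Continuous fun r => M * Real.exp (-(2 * γ) * r) * ((1 + ‖ξ‖) ^ K)⁻¹).intervalIntegrable _ _
  calc ‖∫ r in (0 : ℝ)..t, heat (4 * π ^ 2) ξ (t - r) • nonlin (d.freeC r) (d.freeC r) ξ‖
      ≤ ∫ r in (0 : ℝ)..t, M * Real.exp (-(2 * γ) * r) * ((1 + ‖ξ‖) ^ K)⁻¹ := by
        refine intervalIntegral.norm_integral_le_of_norm_le ht (Eventually.of_forall fun r hr => ?_) hint
        rw [norm_smul, Real.norm_of_nonneg (heat_nonneg _ _ _)]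
        calc heat (4 * π ^ 2) ξ (t - r) * ‖nonlin (d.freeC r) (d.freeC r) ξ‖
            ≤ 1 * (M * Real.exp (-(2 * γ) * r) * ((1 + ‖ξ‖) ^ K)⁻¹) :=
              mul_le_mul (heat_le_one (by positivity) (by linarith [hr.2]) ξ) (hnl r hr.1.le)
                (norm_nonneg _) zero_le_one
          _ = _ := one_mul _
    _ = M * ((1 + ‖ξ‖) ^ K)⁻¹ * ∫ r in (0 : ℝ)..t, Real.exp (-(2 * γ) * r) := by
        rw [← intervalIntegral.integral_const_mul]
        congr 1; funext r; ring
    _ ≤ M * ((1 + ‖ξ‖) ^ K)⁻¹ * (1 / (2 * γ)) :=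
        mul_le_mul_of_nonneg_left (integral_exp_neg_le' (by positivity) t) (by positivity)
    _ = M * (1 / (2 * γ)) * ((1 + ‖ξ‖) ^ K)⁻¹ := by ring

/-- **The clamped second iterate** `u₁ᶜ(t) = u₁(max t 0)`. [folklore] -/
def u1C (t : ℝ) : E3 → Fin 3 → ℂ := d.secondIterate (max t 0)

/-- For `t ≥ 0`, `u₁ᶜ(t) = u₁(t)`. [folklore] -/
theorem u1C_of_nonneg {t : ℝ} (ht : 0 ≤ t) : d.u1C t = d.secondIterate t := by
  rw [u1C, max_eq_left ht]

/-- `u₁ᶜ` is jointly continuous. [folklore] -/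
theorem continuous_u1C : Continuous (uncurry d.u1C) := by
  change Continuous ((uncurry d.secondIterate) ∘ fun p : ℝ × E3 => (max p.1 0, p.2))
  exact d.continuous_secondIterate.comp ((continuous_fst.max continuous_const).prodMk continuous_snd)

/-- **Uniform decay of `u₁ᶜ`**, of every order, for all times. [folklore] -/
theorem hasDecay_u1C (K : ℕ) : ∃ B : ℝ, ∀ t, HasDecay K B (d.u1C t) := by
  obtain ⟨B, hB⟩ := d.hasDecay_secondIterate_uniform K
  exact ⟨B, fun t => hB (max t 0) (le_max_right _ _)⟩

/-- **The remainder** `y = V − Uᶜ + u₁ᶜ` of a Fourier-side field `V`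
(Bourgain–Pavlović's `y = u − e^{tΔ}u₀ + u₁`, §3.3). [cite: BourgainPavlovic2008, §3.3] -/
def remainder (V : ℝ → E3 → Fin 3 → ℂ) (t : ℝ) (ξ : E3) : Fin 3 → ℂ :=
  V t ξ - d.freeC t ξ + d.u1C t ξ

/-- The remainder of a jointly continuous field is jointly continuous. [folklore] -/
theorem continuous_remainder {V : ℝ → E3 → Fin 3 → ℂ} (hV : Continuous (uncurry V)) :
    Continuous (uncurry (d.remainder V)) := by
  change Continuous fun p : ℝ × E3 => V p.1 p.2 - d.freeC p.1 p.2 + d.u1C p.1 p.2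
  exact (hV.sub d.continuous_freeC).add d.continuous_u1C

/-- The remainder of a uniformly decaying field decays uniformly, of every order available. [folklore] -/
theorem hasDecay_remainder {V : ℝ → E3 → Fin 3 → ℂ} {K : ℕ} (hV : ∃ A, ∀ t, HasDecay K A (V t)) :
    ∃ B, ∀ t, HasDecay K B (d.remainder V t) := by
  obtain ⟨A, hA⟩ := hV
  obtain ⟨B, hB⟩ := d.hasDecay_u1C K
  refine ⟨A + 4 * d.α * d.r * d.suppRadius * (1 + d.suppRadius) ^ K + B, fun t => ?_⟩
  have h := ((hA t).sub (d.hasDecay_freeC t K)).add (hB t)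
  exact h

/-- **The remainder identity.** For a Fourier-side mild solution `V` on `[0, F]` issued from the
datum, `y = −𝓑(y, V) + 𝓑(u₁ᶜ, V) − 𝓑(Uᶜ, y) + 𝓑(Uᶜ, u₁ᶜ)` on `[0, F]`
(`𝓑 = duhamelBilin (4π²)`; Bourgain–Pavlović's equation (3.13) for `y`, in integral form, with the
unknown kept whole in the first two terms). [cite: BourgainPavlovic2008, (3.13)] -/
theorem remainder_identity {F : ℝ} {V : ℝ → E3 → Fin 3 → ℂ} (hV : IsFourierMild (4 * π ^ 2) 4 0 F V)
    (hV0 : V 0 = d.datum) {t : ℝ} (ht : t ∈ Icc 0 F) (ξ : E3) :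
    d.remainder V t ξ =
      -duhamelBilin (4 * π ^ 2) (d.remainder V) V t ξ + duhamelBilin (4 * π ^ 2) d.u1C V t ξ -
        duhamelBilin (4 * π ^ 2) d.freeC (d.remainder V) t ξ + duhamelBilin (4 * π ^ 2) d.freeC d.u1C t ξ := by
  have h4 := card_fin_three_lt_four
  obtain ⟨AV, hAV⟩ := hV.decay 4
  obtain ⟨Au, hAu⟩ := d.hasDecay_u1C 4
  obtain ⟨Ay, hAy⟩ := d.hasDecay_remainder (K := 4) ⟨AV, hAV⟩
  have hU := fun t => d.hasDecay_freeC t 4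
  have hVc := hV.cont
  have hyc := d.continuous_remainder hVc
  -- `V − Uᶜ = y − u₁ᶜ` as functions
  have hfun : V - d.freeC = d.remainder V - d.u1C := by
    funext s η; simp [remainder]
  -- the mild formula and the free evolution
  have hmild := hV.eq_heat_smul_sub_duhamelBilin ht ξ
  have hfree : d.freeC t ξ = heat (4 * π ^ 2) ξ t • d.datum ξ := by
    rw [d.freeC_of_nonneg ht.1, free_apply]
  have hu1 : d.u1C t ξ = duhamelBilin (4 * π ^ 2) d.freeC d.freeC t ξ := by
    rw [d.u1C_of_nonneg ht.1, secondIterate]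
  -- bilinearity
  have e1 : duhamelBilin (4 * π ^ 2) V V t ξ - duhamelBilin (4 * π ^ 2) d.freeC d.freeC t ξ =
      duhamelBilin (4 * π ^ 2) (V - d.freeC) V t ξ + duhamelBilin (4 * π ^ 2) d.freeC (V - d.freeC) t ξ := by
    rw [duhamelBilin_sub_left h4 _ hVc d.continuous_freeC hVc hAV hU hAV,
      duhamelBilin_sub_right h4 _ d.continuous_freeC hVc d.continuous_freeC hU hAV hU]
    ring
  have e2 : duhamelBilin (4 * π ^ 2) (V - d.freeC) V t ξ =
      duhamelBilin (4 * π ^ 2) (d.remainder V) V t ξ - duhamelBilin (4 * π ^ 2) d.u1C V t ξ := by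
    rw [hfun, duhamelBilin_sub_left h4 _ hyc d.continuous_u1C hVc hAy hAu hAV]
  have e3 : duhamelBilin (4 * π ^ 2) d.freeC (V - d.freeC) t ξ =
      duhamelBilin (4 * π ^ 2) d.freeC (d.remainder V) t ξ - duhamelBilin (4 * π ^ 2) d.freeC d.u1C t ξ := by
    rw [hfun, duhamelBilin_sub_right h4 _ d.continuous_freeC hyc d.continuous_u1C hU hAy hAu]
  -- assemble
  have key : d.remainder V t ξ = -(duhamelBilin (4 * π ^ 2) V V t ξ - duhamelBilin (4 * π ^ 2) d.freeC d.freeC t ξ) := by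
    rw [remainder, hmild, hV0, hfree, hu1]; abel
  rw [key, e1, e2, e3]; abel

/-! ### The main inequality -/

/-- The constant of `pathNorm_duhamelBilin_le` at `c = 4π²`: `C_G = 36π (1 + 1/(4π²))`. [folklore] -/
def CG : ℝ≥0∞ := nonlinMassConst (Fin 3) * (1 + ENNReal.ofReal (4 * π ^ 2)⁻¹)

/-- `C_G < ∞`. [folklore] -/
theorem CG_lt_top : CG < ⊤ :=
  ENNReal.mul_lt_top nonlinMassConst_lt_top (ENNReal.add_lt_top.2 ⟨ENNReal.one_lt_top, ENNReal.ofReal_lt_top⟩)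

/-- **The linear coefficient** `λ(T) = C_G (12 α m + 96 α² r m² √T + 4000 α² m²)` (twice the three
coefficient budgets). [cite: BourgainPavlovic2008, (3.15)–(3.21), (3.26)–(3.37)] -/
def linCoef (T : ℝ) : ℝ≥0∞ :=
  CG * (2 * ENNReal.ofReal (6 * d.α * d.bumpMass) + 2 * ENNReal.ofReal (48 * d.α ^ 2 * d.r * d.bumpMass ^ 2 * Real.sqrt T) +
    2 * ENNReal.ofReal (2000 * d.α ^ 2 * d.bumpMass ^ 2))

/-- **The forcing** `ε(T) = C_G (2 E₁ + E₂) ≤ C_G (1320 α³ r m³ + 2304 α⁴ r² m⁴ T + 219000 α⁴ r m⁴)`. [cite: BourgainPavlovic2008, (3.22)–(3.25)] -/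
def forcing (T : ℝ) : ℝ≥0∞ :=
  CG * (2 * ENNReal.ofReal (660 * d.α ^ 3 * d.r * d.bumpMass ^ 3) +
    ENNReal.ofReal (2304 * d.α ^ 4 * d.r ^ 2 * d.bumpMass ^ 4 * T + 219000 * d.α ^ 4 * d.bumpMass ^ 4 * d.r))

/-- The mass of the second iterate is at most the sum over the low and the high pairs. [folklore] -/
theorem massL1_secondIterate_le_pairs (r : ℝ) :
    massL1 (d.secondIterate r) ≤ ∑ p ∈ d.lowPairs, massL1 (d.pairTerm p.1 p.2 r) +
      ∑ p ∈ d.highPairs, massL1 (d.pairTerm p.1 p.2 r) := by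
  classical
  have hsum : massL1 (d.secondIterate r) ≤ ∑ p ∈ d.idx ×ˢ d.idx, massL1 (d.pairTerm p.1 p.2 r) := by
    rw [massL1_eq]
    have hpt : ∀ ξ, ‖d.secondIterate r ξ‖ₑ ≤ ∑ p ∈ d.idx ×ˢ d.idx, ‖d.pairTerm p.1 p.2 r ξ‖ₑ := by
      intro ξ
      rw [d.secondIterate_eq_sum r ξ, ← Finset.sum_product']
      exact enorm_sum_le _ _
    calc ∫⁻ ξ, ‖d.secondIterate r ξ‖ₑ ≤ ∫⁻ ξ, ∑ p ∈ d.idx ×ˢ d.idx, ‖d.pairTerm p.1 p.2 r ξ‖ₑ :=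
          lintegral_mono hpt
      _ = ∑ p ∈ d.idx ×ˢ d.idx, massL1 (d.pairTerm p.1 p.2 r) := by
          rw [lintegral_finsetSum' _ fun p _ =>
            ((d.continuous_pairTerm p.1 p.2).uncurry_left r).aestronglyMeasurable.enorm]
          rfl
  refine hsum.trans (le_of_eq ?_)
  rw [lowPairs, highPairs, Finset.sum_filter_add_sum_filter_not]

/-- **The pair interactions of `u₁` against the path norm**:
`∫₀^{F} (∑_pairs massL1(pairTerm p r)) massL1(y r) dr ≤ (K_lo(F) + K_hi) pathNorm F y`. [cite: BourgainPavlovic2008, (3.25)–(3.37)] -/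
theorem lintegral_pairs_mul_le {F : ℝ} (hF : 0 ≤ F) {y : ℝ → E3 → Fin 3 → ℂ} (hy : Continuous (uncurry y)) :
    ∫⁻ r in Ioc 0 F, (∑ p ∈ d.lowPairs, massL1 (d.pairTerm p.1 p.2 r) +
        ∑ p ∈ d.highPairs, massL1 (d.pairTerm p.1 p.2 r)) * massL1 (y r) ≤
      (ENNReal.ofReal (48 * d.α ^ 2 * d.r * d.bumpMass ^ 2 * Real.sqrt F) +
        ENNReal.ofReal (2000 * d.α ^ 2 * d.bumpMass ^ 2)) * pathNorm F y := by
  have hmeas : ∀ p : (ℕ × Bool × Bool) × (ℕ × Bool × Bool),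
      AEMeasurable (fun r => massL1 (d.pairTerm p.1 p.2 r) * massL1 (y r)) (volume.restrict (Ioc 0 F)) :=
    fun p => ((measurable_massL1 (d.continuous_pairTerm p.1 p.2)).mul (measurable_massL1 hy)).aemeasurable
  calc ∫⁻ r in Ioc 0 F, (∑ p ∈ d.lowPairs, massL1 (d.pairTerm p.1 p.2 r) +
          ∑ p ∈ d.highPairs, massL1 (d.pairTerm p.1 p.2 r)) * massL1 (y r)
      = ∫⁻ r in Ioc 0 F, (∑ p ∈ d.lowPairs, massL1 (d.pairTerm p.1 p.2 r) * massL1 (y r) +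
          ∑ p ∈ d.highPairs, massL1 (d.pairTerm p.1 p.2 r) * massL1 (y r)) := by
        refine lintegral_congr fun r => ?_
        rw [add_mul, Finset.sum_mul, Finset.sum_mul]
    _ = (∑ p ∈ d.lowPairs, ∫⁻ r in Ioc 0 F, massL1 (d.pairTerm p.1 p.2 r) * massL1 (y r)) +
          ∑ p ∈ d.highPairs, ∫⁻ r in Ioc 0 F, massL1 (d.pairTerm p.1 p.2 r) * massL1 (y r) := by
        rw [lintegral_add_left' ((Finset.measurable_sum _ fun p _ =>
          (measurable_massL1 (d.continuous_pairTerm p.1 p.2)).mul (measurable_massL1 hy)).aemeasurable)]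
        rw [lintegral_finsetSum' _ fun p _ => hmeas p, lintegral_finsetSum' _ fun p _ => hmeas p]
    _ ≤ _ := by
        rw [add_mul]
        exact add_le_add (d.coefficient_budget_pairs_low hF hy) (d.coefficient_budget_pairs_high (T := F) hy)


/-- Masses are subadditive over three continuous summands: if `V = y + U − u` pointwise then
`massL1 V ≤ massL1 y + massL1 U + massL1 u`. [folklore] -/
theorem massL1_le_add_three {V y U u : E3 → Fin 3 → ℂ} (hy : Continuous y) (hU : Continuous U)
    (h : ∀ ξ, V ξ = y ξ + U ξ - u ξ) : massL1 V ≤ massL1 y + massL1 U + massL1 u := by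
  have hpt : ∀ ξ, ‖V ξ‖ₑ ≤ ‖y ξ‖ₑ + ‖U ξ‖ₑ + ‖u ξ‖ₑ := fun ξ => by
    rw [h ξ]
    calc ‖y ξ + U ξ - u ξ‖ₑ ≤ ‖y ξ + U ξ‖ₑ + ‖u ξ‖ₑ := enorm_sub_le
      _ ≤ ‖y ξ‖ₑ + ‖U ξ‖ₑ + ‖u ξ‖ₑ := add_le_add (enorm_add_le _ _) le_rfl
  calc massL1 V ≤ ∫⁻ ξ, (‖y ξ‖ₑ + ‖U ξ‖ₑ + ‖u ξ‖ₑ) := lintegral_mono hpt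
    _ = massL1 y + massL1 U + massL1 u := by
        rw [lintegral_add_left' (show AEMeasurable (fun ξ => ‖y ξ‖ₑ + ‖U ξ‖ₑ) _ from
            (hy.aestronglyMeasurable.enorm.add hU.aestronglyMeasurable.enorm)),
          lintegral_add_left' (show AEMeasurable (fun ξ => ‖y ξ‖ₑ) _ from hy.aestronglyMeasurable.enorm)]
        rfl

/-- **The main inequality for the remainder.** For a Fourier-side mild solution `V` on `[0, F]`
issued from the datum and `0 < F' ≤ F ≤ T`:
`Z ≤ ε(T) + λ(T) Z + C_G Z_∞ Z₁` with `Z = pathNorm F' y`, `Z_∞ = pathNormInf F' y`,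
`Z₁ = pathNormOne F' y` (Bourgain–Pavlović's (3.14)–(3.38) assembled). [cite: BourgainPavlovic2008, (3.14)–(3.38)] -/
theorem remainder_main_inequality {T F F' : ℝ} (hF' : 0 < F') (hF'F : F' ≤ F) (hFT : F ≤ T)
    {V : ℝ → E3 → Fin 3 → ℂ} (hV : IsFourierMild (4 * π ^ 2) 4 0 F V) (hV0 : V 0 = d.datum) :
    pathNorm F' (d.remainder V) ≤ d.forcing T + d.linCoef T * pathNorm F' (d.remainder V) +
      CG * (pathNormInf F' (d.remainder V) * pathNormOne F' (d.remainder V)) := by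
  have h4 := card_fin_three_lt_four
  have hc : (0 : ℝ) < 4 * π ^ 2 := by positivity
  set c : ℝ := 4 * π ^ 2 with hcdef
  set y := d.remainder V with hydef
  -- regularity of the four fields
  obtain ⟨AV, hAV⟩ := hV.decay 4
  obtain ⟨Au, hAu⟩ := d.hasDecay_u1C 4
  obtain ⟨Ay, hAy⟩ := d.hasDecay_remainder (K := 4) ⟨AV, hAV⟩
  have hU := fun t => d.hasDecay_freeC t 4
  have hVc := hV.cont
  have hyc : Continuous (uncurry y) := d.continuous_remainder hVc
  have hUc := d.continuous_freeC
  have huc := d.continuous_u1C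
  -- the four Duhamel terms
  set A := duhamelBilin c y V with hA
  set B := duhamelBilin c d.u1C V with hB
  set C := duhamelBilin c d.freeC y with hC
  set D := duhamelBilin c d.freeC d.u1C with hD
  have hAc : Continuous (uncurry A) := continuous_duhamelBilin h4 c hyc hVc hAy hAV
  have hBc : Continuous (uncurry B) := continuous_duhamelBilin h4 c huc hVc hAu hAV
  have hCc : Continuous (uncurry C) := continuous_duhamelBilin h4 c hUc hyc hU hAy
  -- Step 1: the identity on `[0, F']`
  have hid : pathNorm F' y = pathNorm F' (fun t ξ => -A t ξ + (B t ξ + (-C t ξ + D t ξ))) := by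
    refine pathNorm_congr fun t ht ξ => ?_
    have := d.remainder_identity hV hV0 ⟨ht.1, ht.2.trans hF'F⟩ ξ
    rw [← hydef] at this
    rw [this]; abel
  -- Step 2: subadditivity
  have hsub : pathNorm F' (fun t ξ => -A t ξ + (B t ξ + (-C t ξ + D t ξ))) ≤
      pathNorm F' A + pathNorm F' B + pathNorm F' C + pathNorm F' D := by
    have s1 := pathNorm_le_add_of_norm_le (T := F') (Θ := fun t ξ => -A t ξ + (B t ξ + (-C t ξ + D t ξ)))
      (Φ := A) (Ψ := fun t ξ => B t ξ + (-C t ξ + D t ξ)) hAc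
      (fun t _ ξ => by
        calc ‖-A t ξ + (B t ξ + (-C t ξ + D t ξ))‖ ≤ ‖-A t ξ‖ + ‖B t ξ + (-C t ξ + D t ξ)‖ := norm_add_le _ _
          _ = ‖A t ξ‖ + ‖B t ξ + (-C t ξ + D t ξ)‖ := by rw [norm_neg])
    have s2 := pathNorm_le_add_of_norm_le (T := F') (Θ := fun t ξ => B t ξ + (-C t ξ + D t ξ))
      (Φ := B) (Ψ := fun t ξ => -C t ξ + D t ξ) hBc (fun t _ ξ => norm_add_le _ _)
    have s3 := pathNorm_le_add_of_norm_le (T := F') (Θ := fun t ξ => -C t ξ + D t ξ)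
      (Φ := C) (Ψ := D) hCc
      (fun t _ ξ => by
        calc ‖-C t ξ + D t ξ‖ ≤ ‖-C t ξ‖ + ‖D t ξ‖ := norm_add_le _ _
          _ = ‖C t ξ‖ + ‖D t ξ‖ := by rw [norm_neg])
    calc _ ≤ pathNorm F' A + pathNorm F' (fun t ξ => B t ξ + (-C t ξ + D t ξ)) := s1
      _ ≤ pathNorm F' A + (pathNorm F' B + (pathNorm F' C + pathNorm F' D)) :=
          add_le_add le_rfl (s2.trans (add_le_add le_rfl s3))
      _ = _ := by ring
  -- Step 3: the Duhamel bounds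
  have hCG : CG = nonlinMassConst (Fin 3) * (1 + ENNReal.ofReal c⁻¹) := rfl
  have bA : pathNorm F' A ≤ CG * ∫⁻ r in Ioc 0 F', massL1 (y r) * massL1 (V r) :=
    hCG ▸ pathNorm_duhamelBilin_le hc hyc hVc
  have bB : pathNorm F' B ≤ CG * ∫⁻ r in Ioc 0 F', massL1 (d.u1C r) * massL1 (V r) :=
    hCG ▸ pathNorm_duhamelBilin_le hc huc hVc
  have bC : pathNorm F' C ≤ CG * ∫⁻ r in Ioc 0 F', massL1 (d.freeC r) * massL1 (y r) :=
    hCG ▸ pathNorm_duhamelBilin_le hc hUc hyc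
  have bD : pathNorm F' D ≤ CG * ∫⁻ r in Ioc 0 F', massL1 (d.freeC r) * massL1 (d.u1C r) :=
    hCG ▸ pathNorm_duhamelBilin_le hc hUc huc
  -- Step 4: the mass budgets
  set Z := pathNorm F' y with hZ
  set KU : ℝ≥0∞ := ENNReal.ofReal (6 * d.α * d.bumpMass) with hKU
  set Klo : ℝ≥0∞ := ENNReal.ofReal (48 * d.α ^ 2 * d.r * d.bumpMass ^ 2 * Real.sqrt F') with hKlo
  set Khi : ℝ≥0∞ := ENNReal.ofReal (2000 * d.α ^ 2 * d.bumpMass ^ 2) with hKhi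
  set E₁ : ℝ≥0∞ := ENNReal.ofReal (660 * d.α ^ 3 * d.r * d.bumpMass ^ 3) with hE₁
  set E₂ : ℝ≥0∞ := ENNReal.ofReal (2304 * d.α ^ 4 * d.r ^ 2 * d.bumpMass ^ 4 * F' +
    219000 * d.α ^ 4 * d.bumpMass ^ 4 * d.r) with hE₂
  have hmy : Measurable fun r => massL1 (y r) := measurable_massL1 hyc
  have hmU : Measurable fun r => massL1 (d.freeC r) := measurable_massL1 hUc
  have hmu : Measurable fun r => massL1 (d.u1C r) := measurable_massL1 huc
  -- (i) the free coefficient against `y`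
  have bUy : ∫⁻ r in Ioc 0 F', massL1 (d.freeC r) * massL1 (y r) ≤ KU * Z := by
    calc ∫⁻ r in Ioc 0 F', massL1 (d.freeC r) * massL1 (y r)
        ≤ ∫⁻ r in Ioc 0 F', ∑ a ∈ d.idx, massL1 (d.freePieceC a r) * massL1 (y r) := by
          refine lintegral_mono fun r => ?_
          rw [← Finset.sum_mul]
          exact mul_le_mul' (d.massL1_freeC_le r) le_rfl
      _ = ∑ a ∈ d.idx, ∫⁻ r in Ioc 0 F', massL1 (d.freePieceC a r) * massL1 (y r) :=
          lintegral_finsetSum' _ fun a _ =>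
            ((measurable_massL1 (d.continuous_freePieceC a)).mul hmy).aemeasurable
      _ ≤ KU * Z := d.coefficient_budget_free hyc
  -- (ii) the second iterate against `y`
  have bu1y : ∫⁻ r in Ioc 0 F', massL1 (d.u1C r) * massL1 (y r) ≤ (Klo + Khi) * Z := by
    calc ∫⁻ r in Ioc 0 F', massL1 (d.u1C r) * massL1 (y r)
        ≤ ∫⁻ r in Ioc 0 F', (∑ p ∈ d.lowPairs, massL1 (d.pairTerm p.1 p.2 r) +
            ∑ p ∈ d.highPairs, massL1 (d.pairTerm p.1 p.2 r)) * massL1 (y r) := by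
          refine setLIntegral_mono' measurableSet_Ioc fun r hr => mul_le_mul' ?_ le_rfl
          rw [d.u1C_of_nonneg hr.1.le]
          exact d.massL1_secondIterate_le_pairs r
      _ ≤ (Klo + Khi) * Z := d.lintegral_pairs_mul_le hF'.le hyc
  -- (iii) the forcing integrals
  have bE₁ : ∫⁻ r in Ioc 0 F', massL1 (d.u1C r) * massL1 (d.freeC r) ≤ E₁ := by
    calc ∫⁻ r in Ioc 0 F', massL1 (d.u1C r) * massL1 (d.freeC r)
        = ∫⁻ r in Ioc 0 F', massL1 (d.secondIterate r) * massL1 (d.freeC r) :=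
          setLIntegral_congr_fun measurableSet_Ioc fun r hr => by rw [d.u1C_of_nonneg hr.1.le]
      _ ≤ E₁ := d.forcing_E₁_le F'
  have bE₂ : ∫⁻ r in Ioc 0 F', massL1 (d.u1C r) * massL1 (d.u1C r) ≤ E₂ := by
    calc ∫⁻ r in Ioc 0 F', massL1 (d.u1C r) * massL1 (d.u1C r)
        = ∫⁻ r in Ioc 0 F', massL1 (d.secondIterate r) * massL1 (d.secondIterate r) :=
          setLIntegral_congr_fun measurableSet_Ioc fun r hr => by rw [d.u1C_of_nonneg hr.1.le]
      _ ≤ E₂ := d.forcing_E₂_le hF'.le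
  -- (iv) the mass of `V` against the other factors
  have hVsplit : ∀ r, massL1 (V r) ≤ massL1 (y r) + massL1 (d.freeC r) + massL1 (d.u1C r) := fun r =>
    massL1_le_add_three (hyc.uncurry_left r) (hUc.uncurry_left r) fun ξ => by
      simp only [hydef, remainder]; ring
  have bIA : ∫⁻ r in Ioc 0 F', massL1 (y r) * massL1 (V r) ≤
      pathNormInf F' y * pathNormOne F' y + KU * Z + (Klo + Khi) * Z := by
    calc ∫⁻ r in Ioc 0 F', massL1 (y r) * massL1 (V r)
        ≤ ∫⁻ r in Ioc 0 F', (massL1 (y r) * massL1 (y r) + massL1 (d.freeC r) * massL1 (y r) +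
            massL1 (d.u1C r) * massL1 (y r)) := by
          refine lintegral_mono fun r => ?_
          calc massL1 (y r) * massL1 (V r) ≤ massL1 (y r) * (massL1 (y r) + massL1 (d.freeC r) + massL1 (d.u1C r)) :=
                mul_le_mul' le_rfl (hVsplit r)
            _ = _ := by ring
      _ = (∫⁻ r in Ioc 0 F', massL1 (y r) * massL1 (y r)) + (∫⁻ r in Ioc 0 F', massL1 (d.freeC r) * massL1 (y r)) +
            ∫⁻ r in Ioc 0 F', massL1 (d.u1C r) * massL1 (y r) := by
          rw [lintegral_add_left' (show AEMeasurable (fun r => massL1 (y r) * massL1 (y r) +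
              massL1 (d.freeC r) * massL1 (y r)) _ from ((hmy.mul hmy).add (hmU.mul hmy)).aemeasurable),
            lintegral_add_left' (show AEMeasurable (fun r => massL1 (y r) * massL1 (y r)) _ from
              (hmy.mul hmy).aemeasurable)]
      _ ≤ _ := add_le_add (add_le_add (lintegral_massL1_mul_self_le F' hyc) bUy) bu1y
  have bIB : ∫⁻ r in Ioc 0 F', massL1 (d.u1C r) * massL1 (V r) ≤ (Klo + Khi) * Z + E₁ + E₂ := by
    calc ∫⁻ r in Ioc 0 F', massL1 (d.u1C r) * massL1 (V r)
        ≤ ∫⁻ r in Ioc 0 F', (massL1 (d.u1C r) * massL1 (y r) + massL1 (d.u1C r) * massL1 (d.freeC r) +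
            massL1 (d.u1C r) * massL1 (d.u1C r)) := by
          refine lintegral_mono fun r => ?_
          calc massL1 (d.u1C r) * massL1 (V r) ≤ massL1 (d.u1C r) * (massL1 (y r) + massL1 (d.freeC r) + massL1 (d.u1C r)) :=
                mul_le_mul' le_rfl (hVsplit r)
            _ = _ := by ring
      _ = (∫⁻ r in Ioc 0 F', massL1 (d.u1C r) * massL1 (y r)) + (∫⁻ r in Ioc 0 F', massL1 (d.u1C r) * massL1 (d.freeC r)) +
            ∫⁻ r in Ioc 0 F', massL1 (d.u1C r) * massL1 (d.u1C r) := by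
          rw [lintegral_add_left' (show AEMeasurable (fun r => massL1 (d.u1C r) * massL1 (y r) +
              massL1 (d.u1C r) * massL1 (d.freeC r)) _ from ((hmu.mul hmy).add (hmu.mul hmU)).aemeasurable),
            lintegral_add_left' (show AEMeasurable (fun r => massL1 (d.u1C r) * massL1 (y r)) _ from
              (hmu.mul hmy).aemeasurable)]
      _ ≤ _ := add_le_add (add_le_add bu1y bE₁) bE₂
  have bID : ∫⁻ r in Ioc 0 F', massL1 (d.freeC r) * massL1 (d.u1C r) ≤ E₁ := by
    calc ∫⁻ r in Ioc 0 F', massL1 (d.freeC r) * massL1 (d.u1C r)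
        = ∫⁻ r in Ioc 0 F', massL1 (d.u1C r) * massL1 (d.freeC r) := lintegral_congr fun r => mul_comm _ _
      _ ≤ E₁ := bE₁
  -- Step 5: the constants at level `T`
  have hKlo_le : Klo ≤ ENNReal.ofReal (48 * d.α ^ 2 * d.r * d.bumpMass ^ 2 * Real.sqrt T) := by
    refine ENNReal.ofReal_le_ofReal (mul_le_mul_of_nonneg_left (Real.sqrt_le_sqrt (show F' ≤ T by linarith)) ?_)
    have := d.α_pos.le; have := d.bumpMass_nonneg; positivity
  have hE₂_le : E₂ ≤ ENNReal.ofReal (2304 * d.α ^ 4 * d.r ^ 2 * d.bumpMass ^ 4 * T +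
      219000 * d.α ^ 4 * d.bumpMass ^ 4 * d.r) := by
    apply ENNReal.ofReal_le_ofReal
    have := d.α_pos.le; have := d.bumpMass_nonneg
    have hX : 0 ≤ 2304 * d.α ^ 4 * d.r ^ 2 * d.bumpMass ^ 4 := by positivity
    have hF'T : F' ≤ T := by linarith
    nlinarith [mul_le_mul_of_nonneg_left hF'T hX]
  have hlin : CG * (KU + KU + (Klo + Khi) + (Klo + Khi)) ≤ d.linCoef T := by
    rw [linCoef]
    refine mul_le_mul' le_rfl ?_
    rw [← hKU, ← hKhi]
    calc KU + KU + (Klo + Khi) + (Klo + Khi) = 2 * KU + 2 * Klo + 2 * Khi := by ring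
      _ ≤ 2 * KU + 2 * ENNReal.ofReal (48 * d.α ^ 2 * d.r * d.bumpMass ^ 2 * Real.sqrt T) + 2 * Khi := by
          gcongr
  have hforc : CG * (E₁ + E₁ + E₂) ≤ d.forcing T := by
    rw [forcing]
    refine mul_le_mul' le_rfl ?_
    rw [← hE₁]
    calc E₁ + E₁ + E₂ = 2 * E₁ + E₂ := by ring
      _ ≤ 2 * E₁ + _ := add_le_add le_rfl hE₂_le
  -- assemble
  calc Z = pathNorm F' (fun t ξ => -A t ξ + (B t ξ + (-C t ξ + D t ξ))) := hid
    _ ≤ pathNorm F' A + pathNorm F' B + pathNorm F' C + pathNorm F' D := hsub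
    _ ≤ CG * (pathNormInf F' y * pathNormOne F' y + KU * Z + (Klo + Khi) * Z) +
        CG * ((Klo + Khi) * Z + E₁ + E₂) + CG * (KU * Z) + CG * E₁ := by
        refine add_le_add (add_le_add (add_le_add (bA.trans (mul_le_mul' le_rfl bIA))
          (bB.trans (mul_le_mul' le_rfl bIB))) (bC.trans (mul_le_mul' le_rfl bUy))) (bD.trans (mul_le_mul' le_rfl bID))
    _ = CG * (E₁ + E₁ + E₂) + CG * (KU + KU + (Klo + Khi) + (Klo + Khi)) * Z +
        CG * (pathNormInf F' y * pathNormOne F' y) := by ring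
    _ ≤ d.forcing T + d.linCoef T * Z + CG * (pathNormInf F' y * pathNormOne F' y) :=
        add_le_add (add_le_add hforc (mul_le_mul' hlin le_rfl)) le_rfl

/-! ### The bootstrap -/

/-- **Absorption in `ℝ≥0∞`**: `Z < ∞` and `4Z ≤ 4ε + Z + Z` give `Z ≤ 2ε`. [folklore] -/
theorem absorb_four {Z ε : ℝ≥0∞} (hZ : Z ≠ ⊤) (h : 4 * Z ≤ 4 * ε + Z + Z) : Z ≤ 2 * ε := by
  have h2Z : 2 * Z ≠ ⊤ := ENNReal.mul_ne_top ENNReal.ofNat_ne_top hZ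
  have h' : 2 * Z + 2 * Z ≤ 2 * (2 * ε) + 2 * Z := by
    calc 2 * Z + 2 * Z = 4 * Z := by ring
      _ ≤ 4 * ε + Z + Z := h
      _ = 2 * (2 * ε) + 2 * Z := by ring
  have h'' : 2 * Z ≤ 2 * (2 * ε) := ENNReal.le_of_add_le_add_right h2Z h'
  exact (ENNReal.mul_le_mul_iff_right two_ne_zero ENNReal.ofNat_ne_top).1 h''

/-- **The closed estimate at a level where the integral part is small.** If
`4 C_G Z₁(F') ≤ 1` and `4 λ ≤ 1` then `pathNorm F' y ≤ 2 ε`. [cite: BourgainPavlovic2008, (3.38)–(3.39)] -/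
theorem remainder_pathNorm_le_of_small {T F F' : ℝ} (hF' : 0 < F') (hF'F : F' ≤ F) (hFT : F ≤ T)
    {V : ℝ → E3 → Fin 3 → ℂ} (hV : IsFourierMild (4 * π ^ 2) 4 0 F V) (hV0 : V 0 = d.datum)
    (hlin : 4 * d.linCoef T ≤ 1) (hsmall : 4 * (CG * pathNormOne F' (d.remainder V)) ≤ 1) :
    pathNorm F' (d.remainder V) ≤ 2 * d.forcing T := by
  set y := d.remainder V with hy
  obtain ⟨A5, hA5⟩ := d.hasDecay_remainder (K := 5) (hV.decay 5)
  have hfin : pathNorm F' y ≠ ⊤ := (pathNorm_lt_top (T := F') fun t _ => hA5 t).ne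
  have hmain := d.remainder_main_inequality hF' hF'F hFT hV hV0
  rw [← hy] at hmain
  refine absorb_four hfin ?_
  have h1 : 4 * (d.linCoef T * pathNorm F' y) ≤ pathNorm F' y := by
    calc 4 * (d.linCoef T * pathNorm F' y) = (4 * d.linCoef T) * pathNorm F' y := by ring
      _ ≤ 1 * pathNorm F' y := mul_le_mul' hlin le_rfl
      _ = pathNorm F' y := one_mul _
  have h2 : 4 * (CG * (pathNormInf F' y * pathNormOne F' y)) ≤ pathNorm F' y := by
    calc 4 * (CG * (pathNormInf F' y * pathNormOne F' y)) = (4 * (CG * pathNormOne F' y)) * pathNormInf F' y := by ring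
      _ ≤ 1 * pathNormInf F' y := mul_le_mul' hsmall le_rfl
      _ = pathNormInf F' y := one_mul _
      _ ≤ pathNorm F' y := pathNormInf_le_pathNorm
  calc 4 * pathNorm F' y ≤ 4 * (d.forcing T + d.linCoef T * pathNorm F' y + CG * (pathNormInf F' y * pathNormOne F' y)) :=
        mul_le_mul' le_rfl hmain
    _ = 4 * d.forcing T + 4 * (d.linCoef T * pathNorm F' y) + 4 * (CG * (pathNormInf F' y * pathNormOne F' y)) := by ring
    _ ≤ 4 * d.forcing T + pathNorm F' y + pathNorm F' y := add_le_add (add_le_add le_rfl h1) h2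

/-- **The bootstrap.** For a Fourier-side mild solution `V` on `[0, F]` issued from the datum,
`0 < F ≤ T`, with `4 λ(T) ≤ 1` and `16 C_G ε(T) ≤ 1`: `pathNorm F y ≤ 2 ε(T)`
(Bourgain–Pavlović's (3.39); the continuity argument in the length of the interval is run
discretely, through the Lipschitz bound of `F ↦ Z₁(F)` given by the a priori decay of `V`). [cite: BourgainPavlovic2008, (3.39)] -/
theorem remainder_pathNorm_le {T F : ℝ} (hF : 0 < F) (hFT : F ≤ T)
    {V : ℝ → E3 → Fin 3 → ℂ} (hV : IsFourierMild (4 * π ^ 2) 4 0 F V) (hV0 : V 0 = d.datum)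
    (hlin : 4 * d.linCoef T ≤ 1) (hforc : 16 * CG * d.forcing T ≤ 1) :
    pathNorm F (d.remainder V) ≤ 2 * d.forcing T := by
  set y := d.remainder V with hy
  -- a priori bounds from the decay of `V`
  obtain ⟨A5, hA5⟩ := d.hasDecay_remainder (K := 5) (hV.decay 5)
  set Mx : ℝ≥0∞ := ENNReal.ofReal A5 * weightOne with hMx
  have hMx_lt : Mx < ⊤ := ENNReal.mul_lt_top ENNReal.ofReal_lt_top weightOne_lt_top
  have hxPos : ∀ t, xPos (y t) ≤ Mx := fun t => xPos_le_of_hasDecay (hA5 t)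
  -- Lipschitz bound of `Z₁`
  have hLip : ∀ {F₁ F₂ : ℝ}, 0 ≤ F₁ → F₁ ≤ F₂ →
      pathNormOne F₂ y ≤ pathNormOne F₁ y + Mx * ENNReal.ofReal (F₂ - F₁) := by
    intro F₁ F₂ h₁ h₁₂
    calc pathNormOne F₂ y ≤ pathNormOne F₁ y + ∫⁻ t in Ioc F₁ F₂, xPos (y t) :=
          pathNormOne_le_add_setLIntegral h₁ h₁₂ y
      _ ≤ pathNormOne F₁ y + ∫⁻ _ in Ioc F₁ F₂, Mx :=
          add_le_add le_rfl (lintegral_mono fun t => hxPos t)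
      _ = pathNormOne F₁ y + Mx * ENNReal.ofReal (F₂ - F₁) := by
          rw [setLIntegral_const, Real.volume_Ioc]
  -- the step size
  set L : ℝ≥0∞ := 8 * CG * Mx with hL
  have hL_lt : L < ⊤ := ENNReal.mul_lt_top (ENNReal.mul_lt_top (by norm_num) CG_lt_top) hMx_lt
  set n : ℕ := ⌈F * L.toReal⌉₊ + 1 with hn
  have hn0 : 0 < n := Nat.succ_pos _
  have hn0' : (0 : ℝ) < n := by exact_mod_cast hn0
  set δ : ℝ := F / n with hδ
  have hδ0 : 0 < δ := div_pos hF hn0'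
  have hnδ : (n : ℝ) * δ = F := by rw [hδ]; field_simp
  have hstep : L * ENNReal.ofReal δ ≤ 1 := by
    rw [← ENNReal.ofReal_toReal hL_lt.ne, ← ENNReal.ofReal_mul ENNReal.toReal_nonneg, ← ENNReal.ofReal_one]
    refine ENNReal.ofReal_le_ofReal ?_
    rw [hδ, mul_div_assoc', div_le_one hn0']
    calc L.toReal * F = F * L.toReal := mul_comm _ _
      _ ≤ ⌈F * L.toReal⌉₊ := Nat.le_ceil _
      _ ≤ n := by rw [hn]; push_cast; linarith
  -- induction on the grid `k δ`
  have hind : ∀ k : ℕ, k ≤ n → 8 * (CG * pathNormOne (k * δ) y) ≤ 1 := by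
    intro k
    induction k with
    | zero =>
      intro _
      have : pathNormOne ((0 : ℕ) * δ) y = 0 := by
        rw [Nat.cast_zero, zero_mul, pathNormOne, Ioc_self, Measure.restrict_empty, lintegral_zero_measure]
      rw [this, mul_zero, mul_zero]; exact zero_le_one
    | succ k ih =>
      intro hk
      have hk' : k ≤ n := Nat.le_of_succ_le hk
      have IH := ih hk'
      have hkδ : 0 ≤ (k : ℝ) * δ := by positivity
      have hle : (k : ℝ) * δ ≤ ((k + 1 : ℕ) : ℝ) * δ := by push_cast; nlinarith
      -- the a priori step
      have hpre : 4 * (CG * pathNormOne (((k + 1 : ℕ) : ℝ) * δ) y) ≤ 1 := by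
        have h1 := hLip hkδ hle
        have hdiff : ((k + 1 : ℕ) : ℝ) * δ - k * δ = δ := by push_cast; ring
        rw [hdiff] at h1
        have h2 : 8 * (CG * pathNormOne (((k + 1 : ℕ) : ℝ) * δ) y) ≤ 2 := by
          calc 8 * (CG * pathNormOne (((k + 1 : ℕ) : ℝ) * δ) y)
              ≤ 8 * (CG * (pathNormOne (k * δ) y + Mx * ENNReal.ofReal δ)) := by gcongr
            _ = 8 * (CG * pathNormOne (k * δ) y) + L * ENNReal.ofReal δ := by rw [hL]; ring
            _ ≤ 1 + 1 := add_le_add IH hstep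
            _ = 2 := by norm_num
        have h3 : 2 * (4 * (CG * pathNormOne (((k + 1 : ℕ) : ℝ) * δ) y)) ≤ 2 * 1 := by
          calc 2 * (4 * (CG * pathNormOne (((k + 1 : ℕ) : ℝ) * δ) y))
              = 8 * (CG * pathNormOne (((k + 1 : ℕ) : ℝ) * δ) y) := by ring
            _ ≤ 2 := h2
            _ = 2 * 1 := (mul_one _).symm
        exact (ENNReal.mul_le_mul_iff_right two_ne_zero ENNReal.ofNat_ne_top).1 h3
      -- the closed estimate at this level
      have hF'pos : 0 < ((k + 1 : ℕ) : ℝ) * δ := by positivity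
      have hF'le : ((k + 1 : ℕ) : ℝ) * δ ≤ F := by
        rw [← hnδ]
        exact mul_le_mul_of_nonneg_right (by exact_mod_cast hk) hδ0.le
      have hZ := d.remainder_pathNorm_le_of_small hF'pos hF'le hFT hV hV0 hlin hpre
      calc 8 * (CG * pathNormOne (((k + 1 : ℕ) : ℝ) * δ) y)
          ≤ 8 * (CG * (2 * d.forcing T)) :=
            mul_le_mul' le_rfl (mul_le_mul' le_rfl (pathNormOne_le_pathNorm.trans hZ))
        _ = 16 * CG * d.forcing T := by ring
        _ ≤ 1 := hforc
  -- conclude at `k = n`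
  have hlast := hind n le_rfl
  rw [hnδ] at hlast
  have hpre : 4 * (CG * pathNormOne F y) ≤ 1 :=
    le_trans (mul_le_mul' (by norm_num) le_rfl) hlast
  exact d.remainder_pathNorm_le_of_small hF le_rfl hFT hV hV0 hlin hpre

end InflationParams

end Literature.Analysis.FluidPDE.BourgainPavlovic
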